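/-
COR-CM (cell pub-hodgecm2, stage 2 of the Hodge ladder) — count-neutral KERNEL COMBINATORICS «dicyclic twist, even order: the strict-half functionals»
(seat prover-pub-hodgecm2-b23-g43-0, binder prover b23, gen 43; claim DICYCLIC-EVEN, HOME/INBOX.md l.10881; blanket `Census/DicyclicTwist*`).
Bookkeeping definitions with bodies (`loI`, `upI`, `sgI`, `eqI`, the four weights `wE`, `wX`, `wS₁`, `wS₀` and the four functionals `UE`, `UX`,
`SE₁`, `SE₀`) + theorems, on top of the odd lane `Census/DicyclicTwistModel` … `Census/DicyclicTwistCount.lean` (gen 42; its model, faces, descent and bookkeeping are parity-free and used BY NAME);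
no `decide` beyond closed identities in `ZMod 2`, no certificate, no named fact, no `sorry`.  `Interfaces.lean` (C1), every E term, B01,
`Transposition/*`, `PortJoin/*` untouched.
HONEST FRAMING: `HC_CM` is NOT proved, here or anywhere in the tree; nothing here is a period, a count of record or a headline.
T5: n/a-class (no hypothesis binders beyond the model's data); checker: self, 2026-08-23.
-/
import Summits.HodgeConjecture.CorCM.Census.DicyclicTwistCount

/-!
# The dicyclic twist `Dic(ℤ/2 × A)`, `|A|` even, I: the STRICT-HALF functionals `UE s`, `UX s = UE s ∘ x⁻¹`, `SE₁`, `SE₀ = SE₁ ∘ x⁻¹`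

Part IV of the lane (`Census/DicyclicTwistFunctionals.lean`, gen 42) built, for `|A|` ODD, `2|A| + 2` functionals killing the pairs and EVERY
potential-reducing face.  For `|A| = m` EVEN the weight EQUATOR `wt ψ = m/2` exists, the pairs together with ALL reducing faces already span the
Hodge lattice `H₂` (numerically: corank `0` for `m = 4, 6`), and no functional can kill every reducing face.  This file sets up the functionals of
the even lane, which kill the pairs and a RULE CLASS of reducing faces (part `Census/DicyclicTwistEvenRule.lean`):

* the STRICT half indicators `loI φ = [2·wt φ < m]`, `upI φ = [m < 2·wt φ]`, the sign `sgI = loI − upI` (seat b09's `sgn` of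
  `Census/EvenSliceFacesGenerate.lean`, as a difference of indicators) and the equator indicator `eqI = 1 − loI − upI`;
* **`UE s`** (`s ∈ A`), the dot product with `wE s (a, b) = [a lo]·[b up]·[b s = 0] − [a up]·[b lo]·[b s = 1]` — gen 42's `U s` with STRICT
  halves — and **`UX s = UE s ∘ x⁻¹`**, the dot product with `wX s (a, b) = [a up]·[b up]·[a (−s) = 0] − [a lo]·[b lo]·[a (−s) = 1]`;
* **`SE₁`**, the dot product with `wS₁ (a, b) = sg b + [b eq]·sg a`, and **`SE₀ = SE₁ ∘ x⁻¹`**, with `wS₀ (a, b) = sg a − [a eq]·sg b`.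

CONTENT.  §1 the indicators and their behaviour under conjugation, translation and reversal; §2 the weights: ODD under conjugation
(`wE_conj`, …), so the functionals kill the pairs (`UE_pairVec₂`, …); `wE`, `wX` VANISH on every label with a coordinate on the equator
(`wE_eq_zero_of_fst_eq`, …) and `wE` on every label with constant second coordinate; §3 the functionals as `ℤ`-linear maps and their unit-vector
values; the sequel `Census/DicyclicTwistEvenMotion.lean` transports the four functionals under the group (`UX s = UE s ∘ x⁻¹`, `SE₀ = SE₁ ∘ x⁻¹`,
translation shifts `s`, conjugation negates).  All [folklore].

## References
* [Pohlmann1968] H. Pohlmann, Algebraic cycles on abelian varieties of complex multiplication type, Ann. of Math. 88 (1968), Thm 1.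
-/

namespace Summit.HodgeConjecture.CorCM.Census.DicyclicTwist

open Finset
open Summit.HodgeConjecture.CorCM.Census.OddSliceFacesModel
open Summit.HodgeConjecture.CorCM.Census.OddSliceFacesSquares
open Summit.HodgeConjecture.CorCM.Census.OddSliceFacesDescent
open Summit.HodgeConjecture.CorCM.Census.EvenSliceFacesDescent

variable (A : Type) [AddCommGroup A] [Fintype A] [DecidableEq A]

/-! ## §1 Strict half indicators -/

/-- The strict lower-half indicator `[2·wt φ < |A|]`. [folklore] -/
def loI (φ : Ty A) : ℤ := if 2 * wt A φ < Fintype.card A then 1 else 0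

/-- The strict upper-half indicator `[|A| < 2·wt φ]`. [folklore] -/
def upI (φ : Ty A) : ℤ := if Fintype.card A < 2 * wt A φ then 1 else 0

/-- The sign `[lo] − [up]` (`+1 / −1 / 0` below / above / on the equator). [folklore] -/
def sgI (φ : Ty A) : ℤ := loI A φ - upI A φ

/-- The equator indicator `[2·wt φ = |A|] = 1 − [lo] − [up]`. [folklore] -/
def eqI (φ : Ty A) : ℤ := 1 - loI A φ - upI A φ

omit [AddCommGroup A] [DecidableEq A] in
/-- Conjugation swaps the strict halves: `[φ̄ lo] = [φ up]`. [folklore] -/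
theorem loI_add_one (φ : Ty A) : loI A (φ + 1) = upI A φ := by
  unfold loI upI
  have h := wt_le A φ
  rw [wt_add_one]
  by_cases hu : Fintype.card A < 2 * wt A φ
  · rw [if_pos hu, if_pos (by omega)]
  · rw [if_neg hu, if_neg (by omega)]

omit [AddCommGroup A] [DecidableEq A] in
/-- `[φ̄ up] = [φ lo]`. [folklore] -/
theorem upI_add_one (φ : Ty A) : upI A (φ + 1) = loI A φ := by
  unfold loI upI
  have h := wt_le A φ
  rw [wt_add_one]
  by_cases hl : 2 * wt A φ < Fintype.card A
  · rw [if_pos hl, if_pos (by omega)]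
  · rw [if_neg hl, if_neg (by omega)]

omit [AddCommGroup A] [DecidableEq A] in
/-- The sign is odd under conjugation. [folklore] -/
theorem sgI_add_one (φ : Ty A) : sgI A (φ + 1) = -sgI A φ := by
  unfold sgI; rw [loI_add_one, upI_add_one]; ring

omit [AddCommGroup A] [DecidableEq A] in
/-- The equator indicator is even under conjugation. [folklore] -/
theorem eqI_add_one (φ : Ty A) : eqI A (φ + 1) = eqI A φ := by
  unfold eqI; rw [loI_add_one, upI_add_one]; ring

omit [AddCommGroup A] [DecidableEq A] in
/-- `loI`, `upI` only depend on the weight. [folklore] -/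
theorem loI_congr_wt {φ χ : Ty A} (h : wt A φ = wt A χ) : loI A φ = loI A χ := by unfold loI; rw [h]

omit [AddCommGroup A] [DecidableEq A] in
/-- `upI` only depends on the weight. [folklore] -/
theorem upI_congr_wt {φ χ : Ty A} (h : wt A φ = wt A χ) : upI A φ = upI A χ := by unfold upI; rw [h]

omit [DecidableEq A] in
/-- Translation keeps the halves: `loI (tw (0,t) φ) = loI φ`. [folklore] -/
theorem loI_tw_zero (t : A) (φ : Ty A) : loI A (tw A (0, t) φ) = loI A φ := loI_congr_wt A (wt_tw_zero A t φ)

omit [DecidableEq A] in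
/-- `upI (tw (0,t) φ) = upI φ`. [folklore] -/
theorem upI_tw_zero (t : A) (φ : Ty A) : upI A (tw A (0, t) φ) = upI A φ := upI_congr_wt A (wt_tw_zero A t φ)

omit [DecidableEq A] in
/-- `loI (rev φ) = loI φ`. [folklore] -/
theorem loI_rev (φ : Ty A) : loI A (rev A φ) = loI A φ := loI_congr_wt A (wt_rev A φ)

omit [DecidableEq A] in
/-- `upI (rev φ) = upI φ`. [folklore] -/
theorem upI_rev (φ : Ty A) : upI A (rev A φ) = upI A φ := upI_congr_wt A (wt_rev A φ)

omit [AddCommGroup A] [DecidableEq A] in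
/-- On a strictly low label: `loI = 1`, `upI = 0`. [folklore] -/
theorem loI_upI_of_lt {φ : Ty A} (h : 2 * wt A φ < Fintype.card A) : loI A φ = 1 ∧ upI A φ = 0 := by
  unfold loI upI; exact ⟨if_pos h, if_neg (by omega)⟩

omit [AddCommGroup A] [DecidableEq A] in
/-- On a strictly high label: `loI = 0`, `upI = 1`. [folklore] -/
theorem loI_upI_of_gt {φ : Ty A} (h : Fintype.card A < 2 * wt A φ) : loI A φ = 0 ∧ upI A φ = 1 := by
  unfold loI upI; exact ⟨if_neg (by omega), if_pos h⟩

omit [AddCommGroup A] [DecidableEq A] in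
/-- On the equator: `loI = upI = 0`. [folklore] -/
theorem loI_upI_of_eq {φ : Ty A} (h : 2 * wt A φ = Fintype.card A) : loI A φ = 0 ∧ upI A φ = 0 := by
  unfold loI upI; exact ⟨if_neg (by omega), if_neg (by omega)⟩

omit [AddCommGroup A] [DecidableEq A] in
/-- The constant label `0` is strictly low (`|A| ≥ 1`). [folklore] -/
theorem loI_zero (h1 : 1 ≤ Fintype.card A) : loI A (0 : Ty A) = 1 ∧ upI A (0 : Ty A) = 0 :=
  loI_upI_of_lt A (by rw [wt_zero]; omega)

omit [AddCommGroup A] [DecidableEq A] in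
/-- The constant label `1` is strictly high (`|A| ≥ 1`). [folklore] -/
theorem loI_one (h1 : 1 ≤ Fintype.card A) : loI A (1 : Ty A) = 0 ∧ upI A (1 : Ty A) = 1 := by
  have h := loI_zero A h1
  rw [← zero_add (1 : Ty A), loI_add_one, upI_add_one]
  exact ⟨h.2, h.1⟩

/-! ## §1b The defect indicator under reversal (gen 42's `dft`; `dft_tw_zero` is gen 42's) -/

omit [Fintype A] [DecidableEq A] in
/-- `dft s (rev φ) = dft (−s) φ`. [folklore] -/
theorem dft_rev (s : A) (φ : Ty A) : dft A s (rev A φ) = dft A (-s) φ := rfl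

/-! ## §2 The four weights -/

/-- **The weight of `UE s`**: `[a lo]·[b up]·[b s = 0] − [a up]·[b lo]·[b s = 1]`. [folklore] -/
def wE (s : A) (Ψ : Ty₂ A) : ℤ :=
  loI A Ψ.1 * upI A Ψ.2 * (1 - dft A s Ψ.2) - upI A Ψ.1 * loI A Ψ.2 * dft A s Ψ.2

/-- **The weight of `UX s = UE s ∘ x⁻¹`**: `[a up]·[b up]·[a (−s) = 0] − [a lo]·[b lo]·[a (−s) = 1]`. [folklore] -/
def wX (s : A) (Ψ : Ty₂ A) : ℤ :=
  upI A Ψ.1 * upI A Ψ.2 * (1 - dft A (-s) Ψ.1) - loI A Ψ.1 * loI A Ψ.2 * dft A (-s) Ψ.1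

/-- **The weight of `SE₁`**: `sg b + [b eq]·sg a`. [folklore] -/
def wS₁ (Ψ : Ty₂ A) : ℤ := sgI A Ψ.2 + eqI A Ψ.2 * sgI A Ψ.1

/-- **The weight of `SE₀ = SE₁ ∘ x⁻¹`**: `sg a − [a eq]·sg b`. [folklore] -/
def wS₀ (Ψ : Ty₂ A) : ℤ := sgI A Ψ.1 - eqI A Ψ.1 * sgI A Ψ.2

omit [AddCommGroup A] [DecidableEq A] in
/-- `wE` is odd under conjugation. [folklore] -/
theorem wE_conj (s : A) (a b : Ty A) : wE A s (a + 1, b + 1) = -wE A s (a, b) := by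
  unfold wE; simp only [loI_add_one, upI_add_one, dft_add_one]; ring

omit [DecidableEq A] in
/-- `wX` is odd under conjugation. [folklore] -/
theorem wX_conj (s : A) (a b : Ty A) : wX A s (a + 1, b + 1) = -wX A s (a, b) := by
  unfold wX; simp only [loI_add_one, upI_add_one, dft_add_one]; ring

omit [AddCommGroup A] [DecidableEq A] in
/-- `wS₁` is odd under conjugation. [folklore] -/
theorem wS₁_conj (a b : Ty A) : wS₁ A (a + 1, b + 1) = -wS₁ A (a, b) := by
  unfold wS₁; simp only [sgI_add_one, eqI_add_one]; ring

omit [AddCommGroup A] [DecidableEq A] in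
/-- `wS₀` is odd under conjugation. [folklore] -/
theorem wS₀_conj (a b : Ty A) : wS₀ A (a + 1, b + 1) = -wS₀ A (a, b) := by
  unfold wS₀; simp only [sgI_add_one, eqI_add_one]; ring

omit [AddCommGroup A] [DecidableEq A] in
/-- `wE` vanishes when the second coordinate is on the equator. [folklore] -/
theorem wE_eq_zero_of_snd_eq (s : A) {a b : Ty A} (h : 2 * wt A b = Fintype.card A) : wE A s (a, b) = 0 := by
  unfold wE; rw [(loI_upI_of_eq A h).1, (loI_upI_of_eq A h).2]; ring

omit [AddCommGroup A] [DecidableEq A] in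
/-- `wE` vanishes when the first coordinate is on the equator. [folklore] -/
theorem wE_eq_zero_of_fst_eq (s : A) {a b : Ty A} (h : 2 * wt A a = Fintype.card A) : wE A s (a, b) = 0 := by
  unfold wE; rw [(loI_upI_of_eq A h).1, (loI_upI_of_eq A h).2]; ring

omit [DecidableEq A] in
/-- `wX` vanishes when the second coordinate is on the equator. [folklore] -/
theorem wX_eq_zero_of_snd_eq (s : A) {a b : Ty A} (h : 2 * wt A b = Fintype.card A) : wX A s (a, b) = 0 := by
  unfold wX; rw [(loI_upI_of_eq A h).1, (loI_upI_of_eq A h).2]; ring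

omit [DecidableEq A] in
/-- `wX` vanishes when the first coordinate is on the equator. [folklore] -/
theorem wX_eq_zero_of_fst_eq (s : A) {a b : Ty A} (h : 2 * wt A a = Fintype.card A) : wX A s (a, b) = 0 := by
  unfold wX; rw [(loI_upI_of_eq A h).1, (loI_upI_of_eq A h).2]; ring

omit [AddCommGroup A] [DecidableEq A] in
/-- `wE` vanishes when the second coordinate is the constant `0`. [folklore] -/
theorem wE_snd_zero (h1 : 1 ≤ Fintype.card A) (s : A) (a : Ty A) : wE A s (a, 0) = 0 := by
  unfold wE; rw [(loI_zero A h1).1, (loI_zero A h1).2, dft_zero]; ring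

omit [AddCommGroup A] [DecidableEq A] in
/-- `wE` vanishes when the second coordinate is the constant `1`. [folklore] -/
theorem wE_snd_one (h1 : 1 ≤ Fintype.card A) (s : A) (a : Ty A) : wE A s (a, 1) = 0 := by
  unfold wE; rw [(loI_one A h1).1, (loI_one A h1).2, dft_one]; ring

omit [AddCommGroup A] [DecidableEq A] in
/-- `wE` depends on the first coordinate only through its strict half. [folklore] -/
theorem wE_fst_congr (s : A) {a a' : Ty A} (hl : loI A a = loI A a') (hu : upI A a = upI A a') (b : Ty A) :
    wE A s (a, b) = wE A s (a', b) := by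
  unfold wE; simp only [hl, hu]

omit [DecidableEq A] in
/-- `wX` depends on the second coordinate only through its strict half. [folklore] -/
theorem wX_snd_congr (s : A) (a : Ty A) {b b' : Ty A} (hl : loI A b = loI A b') (hu : upI A b = upI A b') :
    wX A s (a, b) = wX A s (a, b') := by
  unfold wX; simp only [hl, hu]

/-! ## §3 The functionals -/

/-- **`UE s`**: the dot product with `wE s`. [folklore] -/
def UE (s : A) : (Ty₂ A → ℤ) →ₗ[ℤ] ℤ where
  toFun v := wE A s ⬝ᵥ v
  map_add' v w := dotProduct_add _ _ _
  map_smul' c v := by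
    show wE A s ⬝ᵥ (c • v) = c • (wE A s ⬝ᵥ v)
    exact dotProduct_smul c _ v

/-- **`UX s = UE s ∘ x⁻¹`**: the dot product with `wX s`. [folklore] -/
def UX (s : A) : (Ty₂ A → ℤ) →ₗ[ℤ] ℤ where
  toFun v := wX A s ⬝ᵥ v
  map_add' v w := dotProduct_add _ _ _
  map_smul' c v := by
    show wX A s ⬝ᵥ (c • v) = c • (wX A s ⬝ᵥ v)
    exact dotProduct_smul c _ v

/-- **`SE₁`**: the dot product with `wS₁`. [folklore] -/
def SE₁ : (Ty₂ A → ℤ) →ₗ[ℤ] ℤ where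
  toFun v := wS₁ A ⬝ᵥ v
  map_add' v w := dotProduct_add _ _ _
  map_smul' c v := by
    show wS₁ A ⬝ᵥ (c • v) = c • (wS₁ A ⬝ᵥ v)
    exact dotProduct_smul c _ v

/-- **`SE₀ = SE₁ ∘ x⁻¹`**: the dot product with `wS₀`. [folklore] -/
def SE₀ : (Ty₂ A → ℤ) →ₗ[ℤ] ℤ where
  toFun v := wS₀ A ⬝ᵥ v
  map_add' v w := dotProduct_add _ _ _
  map_smul' c v := by
    show wS₀ A ⬝ᵥ (c • v) = c • (wS₀ A ⬝ᵥ v)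
    exact dotProduct_smul c _ v

omit [AddCommGroup A] in
/-- `UE s` is the dot product with `wE s`. [folklore] -/
theorem UE_apply (s : A) (v : Ty₂ A → ℤ) : UE A s v = wE A s ⬝ᵥ v := rfl

/-- `UX s` is the dot product with `wX s`. [folklore] -/
theorem UX_apply (s : A) (v : Ty₂ A → ℤ) : UX A s v = wX A s ⬝ᵥ v := rfl

omit [AddCommGroup A] in
/-- `SE₁` is the dot product with `wS₁`. [folklore] -/
theorem SE₁_apply (v : Ty₂ A → ℤ) : SE₁ A v = wS₁ A ⬝ᵥ v := rfl

omit [AddCommGroup A] in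
/-- `SE₀` is the dot product with `wS₀`. [folklore] -/
theorem SE₀_apply (v : Ty₂ A → ℤ) : SE₀ A v = wS₀ A ⬝ᵥ v := rfl

omit [AddCommGroup A] in
/-- `UE s` on a unit vector. [folklore] -/
@[simp] theorem UE_single (s : A) (Ψ : Ty₂ A) (c : ℤ) : UE A s (Pi.single Ψ c) = wE A s Ψ * c := by
  show wE A s ⬝ᵥ Pi.single Ψ c = _; rw [dotProduct_single]

/-- `UX s` on a unit vector. [folklore] -/
@[simp] theorem UX_single (s : A) (Ψ : Ty₂ A) (c : ℤ) : UX A s (Pi.single Ψ c) = wX A s Ψ * c := by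
  show wX A s ⬝ᵥ Pi.single Ψ c = _; rw [dotProduct_single]

omit [AddCommGroup A] in
/-- `SE₁` on a unit vector. [folklore] -/
@[simp] theorem SE₁_single (Ψ : Ty₂ A) (c : ℤ) : SE₁ A (Pi.single Ψ c) = wS₁ A Ψ * c := by
  show wS₁ A ⬝ᵥ Pi.single Ψ c = _; rw [dotProduct_single]

omit [AddCommGroup A] in
/-- `SE₀` on a unit vector. [folklore] -/
@[simp] theorem SE₀_single (Ψ : Ty₂ A) (c : ℤ) : SE₀ A (Pi.single Ψ c) = wS₀ A Ψ * c := by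
  show wS₀ A ⬝ᵥ Pi.single Ψ c = _; rw [dotProduct_single]

/-- **The four functionals kill the pairs.** [folklore] -/
theorem killed_pairVec₂ (Ψ : Ty₂ A) :
    (∀ s, UE A s (pairVec₂ A Ψ) = 0) ∧ (∀ s, UX A s (pairVec₂ A Ψ) = 0) ∧ SE₀ A (pairVec₂ A Ψ) = 0 ∧ SE₁ A (pairVec₂ A Ψ) = 0 := by
  obtain ⟨a, b⟩ := Ψ
  refine ⟨fun s => ?_, fun s => ?_, ?_, ?_⟩
  · rw [pairVec₂, map_add, UE_single, UE_single]
    show wE A s (a, b) * 1 + wE A s (a + 1, b + 1) * 1 = 0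
    rw [wE_conj]; ring
  · rw [pairVec₂, map_add, UX_single, UX_single]
    show wX A s (a, b) * 1 + wX A s (a + 1, b + 1) * 1 = 0
    rw [wX_conj]; ring
  · rw [pairVec₂, map_add, SE₀_single, SE₀_single]
    show wS₀ A (a, b) * 1 + wS₀ A (a + 1, b + 1) * 1 = 0
    rw [wS₀_conj]; ring
  · rw [pairVec₂, map_add, SE₁_single, SE₁_single]
    show wS₁ A (a, b) * 1 + wS₁ A (a + 1, b + 1) * 1 = 0
    rw [wS₁_conj]; ring

end Summit.HodgeConjecture.CorCM.Census.DicyclicTwist
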